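/-
Copyright (c) 2026 the pub-hodgecm-mathlib formalisation cell (harness21).  Prover seat hodgecm-mathlib-LH4-p13 (g2), req620 Track A «(D-RAM) FOUR-FRAME» squad
(heir LEAD F0P3a-plan lineage; dealer LH4-plan lineage; MS ROAD A, Stage B brick B4 «SPLIT STRATA» of SPEC `F0/P3c/LH4/LH4-p10/g2/SPEC-StageB.v1.LH4p10g2.md` §C,
FILE 2 of the brick: AXIS 3).  2026-09-04.
-/
import Summits.HodgeConjecture.HodgeConjecture.Theorems.F0P3cDyRamDiagonalStratumTools       -- B4 FILE 1 (this seat): orbit-invariance of the weight, coordinate-congruence indices, parity, Gram blocks; brings ★ TorusDefs, ★ B1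
import Summits.HodgeConjecture.HodgeConjecture.Theorems.F0P3cDyRamDiagonalUnitTorusOrbit     -- ★ (O1) p855595 (LH4-p09): `ncard_unitTorus_orbit_eq_relIndex_unitStabilizer`
import Summits.HodgeConjecture.HodgeConjecture.Theorems.F0P3cDyRamDiagonalStableLatticeHNF  -- ★ p855280 (LH4-p08): `mem_latt_hnf_iff`, `normalised_latt_hnf_iff`
import Summits.HodgeConjecture.HodgeConjecture.Theorems.F0P3cDyRamDiagonalStableLatticeHNFExists  -- ★ p855304 (LH4-p08): `latt_hnf_eq_latt_hnf_iff`
import Summits.HodgeConjecture.HodgeConjecture.Theorems.F0P3cDyRamDiagonalHNFStability      -- ★ p855216 (LH4-p14): `mapGL_latt_hnf_eq_iff`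
import Summits.HodgeConjecture.HodgeConjecture.Theorems.F0P3cDyRamDiagonalCoreUnique         -- ★ p855200 (LH4-p04): `isIntMatrix_diagonal_of_v_le`, `isIntMatrix_diagonal_inv_of_v_eq_one`, `v_det_diagonal_eq_one`
import Summits.HodgeConjecture.HodgeConjecture.Theorems.F0P3cDyRamDiagonalGluedTubeCriterion -- ★ B5 (i) p855737 (LH4-p10): `formCongr_hnf_diagonal` (the Gram matrix of the HNF frame)
import HarnessLib

/-!
# Crux `H413`, MS ROAD A, STAGE B brick B4 «SPLIT STRATA», FILE 2: THE AXIS-3 ON-BRANCH STRATUM `T₃(s)` — `M₃(s,x) = latt (1 0 0; x ϖ^s 0; 0 0 1)`, dualisable iff `s` even,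
# `T`-stable iff `s ≤ n₃`, a single unit-torus orbit of `(q−1)q^{s−1}` lattices of weight `1∕((q−1)q^{s∕2−1})` each: WEIGHTED COUNT `q^{s∕2}`

Cell `hodgecm-mathlib` (D-0151), FLOOR 0, crux item H413 = `stmt-HodgeConjecture-24833`, route of record `HCCMUnconditional`; squad F0∕P3c∕LH4 (req618∕req620).  THEOREMS ONLY
(no `def`, no instance, no notation, no `sorry`, default heartbeats); lane `--supports stmt-HodgeConjecture-24833 --as helper` (count-neutral).  Road target: tree
`Cruxes/H413/Lines/F0_P3c_DyRamFourFrame_U3_Laws.lean` stub `stub_U3_stableModelSum` (MS): `Σ_{M ∈ 𝓛₀(T) dualisable} 1∕[𝒰 : S_F(M)] = [k]_q`; paper proof = LH4-p10 (g2)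
MEMO-stableLaw-finite v2 §3–§4; Lean cut = SPEC-StageB v1 (B3 strata table, B4–B7 per-stratum counts, B8 ★ the sum, B10 assembly).  THIS FILE = B4 for the stratum `T₃(s)`
(«the plane `⟨e₀, e₁⟩` at distance `s` from the splitting sub-building, `e₂` split off»; MEMO §3.1: `c = 0`, `b = s`; §4 (T): `q^{s∕2}` orbits); axes 1, 2 are FILE 3.

WHAT IS PROVED (generic valued field `K`; datum letters `(σ, ϖ, d)` as in ★ B1; `q = Nat.card 𝓀[K]`; `T = diag(α, β, γ)` with unit entries, `|α − β| = |ϖ|^{n₃}` — B10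
feeds these from `IsElementDatum` with `γ = 1`).  §1 `M₃(s,x)` (`x` a unit): dualisable for even `s` (explicit `σ`-fixed form `diag(−xσx·π₀^{−j}, π₀^{−j}, 1)`, `π₀ = ϖσϖ`)
and ONLY for even `s` (FILE 1 §4 at the axis `𝔭^s e₁`); normalised; `diag(u)`-stable iff `|u₁ − u₀| ≤ |ϖ^s|`; stabilisers `{u : u₁ ≡ u₀ (𝔭^s)}`; orbit `diag(u)·M₃(s,x) =
M₃(s, u₁xu₀⁻¹)`; `axis3_hnf_iff` (the loose SPEC shape `∃ x y z, M = latt (1 0 0; x ϖ^s 0; y z 1)` ⟺ `∃ x unit, M = M₃(s,x)` for normalised `M`).  §2 the two indices and the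
weight `1∕((q−1)q^{⌈s∕2⌉−1})` (FILE 1 §3).  §3 the stratum `𝒮₃(s) := {M ∈ 𝓛₀(T) | dualisable, M = M₃(s,x), |x| = 1}` EXHAUSTIVELY: `= 𝒯·M₃(s,1)` if `2 ∣ s ∧ s ≤ n₃`, `= ∅` if
`n₃ < s` or `s` odd; `ncard = (q−1)q^{s−1}` (★ (O1)); HEAD **`finsum_stabiliserWeight_axis3Stratum`: `∑ᶠ M ∈ 𝒮₃(s), stabiliserWeight σ M = q^{s∕2}`** (`2 ∣ s`, `2 ≤ s ≤ n₃`)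
— the B8-planes slot `q^{s∕2}` on `(Icc 2 n₃).filter Even` (MEMO v2 §4 (T)).
HONEST LABEL.  Count-neutral (`--supports`); nothing printed is asserted; (MS) and the census laws stay PROVER TARGETS until B3∕B5–B7∕B9∕B10 land; `HC_CM` is proved only modulo the
7 printed citations (2 remaining named inputs: hLiu418 = `stmt-HodgeConjecture-24832`, h413 = `stmt-HodgeConjecture-24833`) until rung 0 closes.

## References
* [Kottwitz1986BaseChangeUnits] R. E. Kottwitz, *Base change for unit elements of Hecke algebras*, Compositio Math. 60 (1986), §1 pp. 240–241 (orbital integrals of units as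
  lattice counts modulo the torus; the split count).
* [Rogawski1990] J. D. Rogawski, *Automorphic Representations of Unitary Groups in Three Variables*, Ann. of Math. Stud. 123 (1990), §4.9 Prop. 4.9.1 (a) p. 55.
* [Serre1979] J.-P. Serre, *Local Fields*, GTM 67 (1979), Ch. IV §2 Prop. 6 (indices of the unit filtration).
* [Serre1980Trees] J.-P. Serre, *Trees*, Springer (1980), Ch. II §1.1 (lattices, Hermite normal form, the diagonal action).
* [Jacobowitz1962] R. Jacobowitz, *Hermitian forms over local fields*, Amer. J. Math. 84 (1962), §4, §7 (Gram matrices, unimodular lattices).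
-/

set_option autoImplicit false

noncomputable section

namespace Summit.HodgeConjecture.HodgeConjecture.Cruxes.H413.F0P3cDyRamDiagonalSplitCount

open Matrix
open Literature.NumberTheory.Automorphic Literature.NumberTheory.Automorphic.HermitianLattice
open Literature.NumberTheory.Automorphic.UnitaryLatticeTree
open Summit.HodgeConjecture.HodgeConjecture.Cruxes.H413.F0P3cDyRamDiagonalTorusDefs
open Summit.HodgeConjecture.HodgeConjecture.Cruxes.H413.F0P3cDyRamDiagonalStableLatticeHNF (mem_latt_hnf_iff normalised_latt_hnf_iff)
open Summit.HodgeConjecture.HodgeConjecture.Cruxes.H413.F0P3cDyRamDiagonalStratumTools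
open Summit.HodgeConjecture.HodgeConjecture.Cruxes.H413.F0P3cDyRamDiagonalGluedTubeCriterion (formCongr_hnf_diagonal)
open Summit.HodgeConjecture.HodgeConjecture.Cruxes.H413.F0P3cDyRamDiagonalHNFStability (mapGL_latt_hnf_eq_iff)
open Summit.HodgeConjecture.HodgeConjecture.Cruxes.H413.F0P3cDyRamDiagonalCoreUnique
open Summit.HodgeConjecture.HodgeConjecture.Cruxes.H413.F0P3cDyRamDiagonalUnitTorusOrbit
open scoped Valued WithZero Matrix MatrixGroups

variable {K : Type*} [Field K]


/-! ## §1  AXIS 3 — the on-branch stratum `T₃(s)`: `M₃(s,x) = latt (1 0 0; x ϖ^s 0; 0 0 1)` (the plane `⟨e₀,e₁⟩` at distance `s` from the splitting, `e₂` split off) -/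

section Valued

variable [Valued K ℤᵐ⁰]

omit [Valued K ℤᵐ⁰] in
/-- The axis-3 frame is invertible: `det (1 0 0; x ϖ^s 0; 0 0 1) = ϖ^s ≠ 0`. [cite: Serre1980Trees, II §1.1] -/
theorem det_axis3_ne_zero {ϖ : K} (hϖ0 : ϖ ≠ 0) (x : K) (s : ℕ) : (!![1, 0, 0; x, ϖ ^ s, 0; 0, 0, 1] : Matrix (Fin 3) (Fin 3) K).det ≠ 0 := by
  rw [Matrix.det_fin_three]; simp [pow_ne_zero _ hϖ0]

/-- **(T₃·a) EVERY AXIS-3 LATTICE OF EVEN DEPTH IS DUALISABLE.**  For an involution `σ` preserving `|·|`, a uniformiser `ϖ`, a unit `x` and `s = 2j`: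
`M₃(s, x) = latt (1 0 0; x ϖ^s 0; 0 0 1)` is self-dual for the `σ`-fixed diagonal form `diag(−xσx·π₀^{−j}, π₀^{−j}, 1)`, `π₀ = ϖσϖ` — its Gram matrix is
`(0, εσx, 0; σε·x, π₀^j, 0; 0, 0, 1)` with `ε = ϖ^{2j}π₀^{−j}` a unit (rank-2 computation of the (S-fin) count, MEMO v2 §4 (T)). [cite: Jacobowitz1962, §4, §7] [cite: Rogawski1990, §4.9 Prop. 4.9.1 (a) p. 55] -/
theorem isDualisableLattice_latt_axis3 {σ : K →+* K} (hσ : ∀ a, σ (σ a) = a) (hvσ : ∀ a, Valued.v (σ a) = Valued.v a)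
    {ϖ : K} (hϖ : Valued.v ϖ = WithZero.exp (-1 : ℤ)) {x : K} (hx : Valued.v x = 1) {s : ℕ} (h2 : 2 ∣ s) :
    IsDualisableLattice σ ϖ (latt (!![1, 0, 0; x, ϖ ^ s, 0; 0, 0, 1] : Matrix (Fin 3) (Fin 3) K)) := by
  obtain ⟨j, rfl⟩ := h2
  have hϖ0 : ϖ ≠ 0 := fun h0 => by rw [h0, map_zero] at hϖ; exact WithZero.coe_ne_zero hϖ.symm
  have hϖ1 : Valued.v ϖ ≤ 1 := by rw [hϖ, ← WithZero.exp_zero, WithZero.exp_le_exp]; norm_num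
  have hσϖ0 : σ ϖ ≠ 0 := (map_ne_zero σ).2 hϖ0
  have hx0 : x ≠ 0 := fun h => by rw [h, map_zero] at hx; exact zero_ne_one hx
  set π₀ : K := ϖ * σ ϖ with hπ₀
  have hπ₀σ : σ π₀ = π₀ := by rw [hπ₀, map_mul, hσ, mul_comm]
  have hπ₀0 : π₀ ≠ 0 := mul_ne_zero hϖ0 hσϖ0
  set d₁ : K := (π₀ ^ j)⁻¹ with hd₁
  have hd₁σ : σ d₁ = d₁ := by rw [hd₁, map_inv₀, map_pow, hπ₀σ]
  have hd₁0 : d₁ ≠ 0 := inv_ne_zero (pow_ne_zero _ hπ₀0)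
  have hvϖ0 : Valued.v ϖ ≠ 0 := (Valuation.ne_zero_iff _).2 hϖ0
  have hvd₁p : Valued.v d₁ * Valued.v (ϖ ^ (2 * j)) = 1 := by
    rw [hd₁, map_inv₀, map_pow, hπ₀, map_mul, hvσ, ← sq, map_pow, ← pow_mul]
    exact inv_mul_cancel₀ (pow_ne_zero _ hvϖ0)
  refine ⟨![-(σ x * d₁ * x), d₁, 1], ?_, ?_⟩
  · intro i
    fin_cases i
    · refine ⟨?_, ?_⟩
      · show σ (-(σ x * d₁ * x)) = -(σ x * d₁ * x)
        rw [map_neg, map_mul, map_mul, hσ, hd₁σ]; ring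
      · show -(σ x * d₁ * x) ≠ 0
        exact neg_ne_zero.2 (mul_ne_zero (mul_ne_zero ((map_ne_zero σ).2 hx0) hd₁0) hx0)
    · exact ⟨hd₁σ, hd₁0⟩
    · exact ⟨map_one σ, one_ne_zero⟩
  · have hG : formCongr σ (Matrix.GeneralLinearGroup.mkOfDetNeZero _ (det_axis3_ne_zero hϖ0 x (2 * j))) (Matrix.diagonal ![-(σ x * d₁ * x), d₁, 1]) =
        !![0, σ x * d₁ * ϖ ^ (2 * j), 0; σ (ϖ ^ (2 * j)) * d₁ * x, σ (ϖ ^ (2 * j)) * d₁ * ϖ ^ (2 * j), 0; 0, 0, 1] := by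
      rw [formCongr_hnf_diagonal σ _ x 0 0 (ϖ ^ (2 * j)) 1 _ rfl]
      ext i j
      fin_cases i <;> fin_cases j <;> simp
    refine isVertexLattice_zero_of_gram_eq_block₃ hϖ1 _ hG ?_ ?_ ?_ (map_one _)
    · rw [map_mul, map_mul, hvσ, hx, one_mul, hvd₁p]
    · rw [map_mul, map_mul, hvσ, hx, mul_one, mul_comm, hvd₁p]
    · rw [map_mul, map_mul, hvσ, mul_comm (Valued.v (ϖ ^ (2 * j))) (Valued.v d₁), mul_assoc, mul_comm (Valued.v (ϖ ^ (2 * j))),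
        ← mul_assoc, hvd₁p, one_mul, map_pow]
      exact pow_le_one' hϖ1 _

/-- **(T₃·b) NORMALISATION**: for a unit `x` (and `|ϖ| ≤ 1`) the axis-3 lattice `M₃(s,x)` is normalised (every coordinate ideal is `𝒪`; ★ `normalised_latt_hnf_iff`).
[cite: Serre1980Trees, II §1.1] -/
theorem isNormalisedLattice_latt_axis3 {ϖ : K} (hϖ1 : Valued.v ϖ ≤ 1) {x : K} (hx : Valued.v x = 1) (s : ℕ) :
    IsNormalisedLattice (latt (!![1, 0, 0; x, ϖ ^ s, 0; 0, 0, 1] : Matrix (Fin 3) (Fin 3) K)) :=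
  (normalised_latt_hnf_iff (y := 0) (z := 0) (r := 1) hx.le (by rw [map_zero]; exact zero_le) (by rw [map_zero]; exact zero_le)
    (by rw [map_pow]; exact pow_le_one' hϖ1 _) (by rw [map_one])).2 ⟨Or.inr hx, Or.inl (map_one _)⟩

/-- **(T₃·c) STABILITY UNDER A UNIT DIAGONAL `T = diag(u)`**: `T·M₃(s,x) = M₃(s,x) ↔ |u₁ − u₀| ≤ |ϖ^s|` (★ `mapGL_latt_hnf_eq_iff` at `b = s`, `c = 0`, `y = z = 0`: the
only constraint is (S2) `|(u₁−u₀)x| ≤ |ϖ^b|`). [cite: Kottwitz1986BaseChangeUnits, §1 pp. 240–241] -/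
theorem mapGL_latt_axis3_eq_iff {ϖ : K} (hϖ0 : ϖ ≠ 0) (u : Fin 3 → K) (hu : ∀ i, Valued.v (u i) = 1) (T : GL (Fin 3) K)
    (hT : (T : Matrix (Fin 3) (Fin 3) K) = Matrix.diagonal u) {x : K} (hx : Valued.v x = 1) (s : ℕ) :
    mapGL T (latt (!![1, 0, 0; x, ϖ ^ s, 0; 0, 0, 1] : Matrix (Fin 3) (Fin 3) K)) = latt (!![1, 0, 0; x, ϖ ^ s, 0; 0, 0, 1] : Matrix (Fin 3) (Fin 3) K) ↔
      Valued.v (u 1 - u 0) ≤ Valued.v (ϖ ^ s) := by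
  have hV : ((Matrix.GeneralLinearGroup.mkOfDetNeZero _ (det_axis3_ne_zero hϖ0 x s) : GL (Fin 3) K) : Matrix (Fin 3) (Fin 3) K) =
      !![1, 0, 0; x, ϖ ^ s, 0; 0, 0, ϖ ^ 0] := by
    rw [pow_zero]; rfl
  have h := mapGL_latt_hnf_eq_iff hϖ0 u hu T hT _ hV
  rw [show latt (!![1, 0, 0; x, ϖ ^ s, 0; 0, 0, 1] : Matrix (Fin 3) (Fin 3) K) =
      latt ((Matrix.GeneralLinearGroup.mkOfDetNeZero _ (det_axis3_ne_zero hϖ0 x s) : GL (Fin 3) K) : Matrix (Fin 3) (Fin 3) K) from rfl, h]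
  simp only [mul_zero, zero_mul, zero_add, map_zero, zero_le, and_true]
  have hvs : 0 < Valued.v (ϖ ^ s) := (Valuation.pos_iff _).2 (pow_ne_zero _ hϖ0)
  rw [map_mul, map_mul, hx, mul_one, map_inv₀, mul_inv_le_iff₀ hvs, one_mul]

/-- **(T₃·d) THE DIAGONAL STABILISER OF `M₃(s,x)` AMONG UNIT VECTORS**: for `|u_i| = 1`, `diag(u)·M₃(s,x) = M₃(s,x) ↔ |u₁ − u₀| ≤ |ϖ^s|` (`u₁ ≡ u₀ mod 𝔭^s`).
[cite: Kottwitz1986BaseChangeUnits, §1 pp. 240–241] -/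
theorem mem_latticeStabilizer_latt_axis3_iff {ϖ : K} (hϖ0 : ϖ ≠ 0) {x : K} (hx : Valued.v x = 1) (s : ℕ) {u : Fin 3 → Kˣ}
    (hu : ∀ i, Valued.v (u i : K) = 1) :
    u ∈ latticeStabilizer (latt (!![1, 0, 0; x, ϖ ^ s, 0; 0, 0, 1] : Matrix (Fin 3) (Fin 3) K)) ↔ Valued.v ((u 1 : K) - u 0) ≤ Valued.v (ϖ ^ s) := by
  rw [mem_latticeStabilizer_iff]
  exact mapGL_latt_axis3_eq_iff hϖ0 (fun i => (u i : K)) hu (diagGLUnits u) (coe_diagGLUnits u) hx s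

/-- `S̃(M₃(s,x)) = {u ∈ 𝒯 : u₁ ≡ u₀ (𝔭^s)}`. [cite: Kottwitz1986BaseChangeUnits, §1 pp. 240–241] -/
theorem mem_unitStabilizer_latt_axis3_iff {ϖ : K} (hϖ0 : ϖ ≠ 0) {x : K} (hx : Valued.v x = 1) (s : ℕ) (u : Fin 3 → Kˣ) :
    u ∈ unitStabilizer (latt (!![1, 0, 0; x, ϖ ^ s, 0; 0, 0, 1] : Matrix (Fin 3) (Fin 3) K)) ↔
      u ∈ unitTorus K 3 ∧ Valued.v ((u 1 : K) - u 0) ≤ Valued.v (ϖ ^ s) := by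
  rw [F0P3cDyRamDiagonalTorusDefs.unitStabilizer, Subgroup.mem_inf]
  exact ⟨fun ⟨h1, h2⟩ => ⟨h2, (mem_latticeStabilizer_latt_axis3_iff hϖ0 hx s ((mem_unitTorus_iff u).1 h2)).1 h1⟩,
    fun ⟨h2, h1⟩ => ⟨(mem_latticeStabilizer_latt_axis3_iff hϖ0 hx s ((mem_unitTorus_iff u).1 h2)).2 h1, h2⟩⟩

/-- `S_F(M₃(s,x)) = {u ∈ 𝒰 : u₁ ≡ u₀ (𝔭^s)}`. [cite: Rogawski1990, §4.9 Prop. 4.9.1 (a) p. 55] -/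
theorem mem_fixedUnitStabilizer_latt_axis3_iff (σ : K →+* K) {ϖ : K} (hϖ0 : ϖ ≠ 0) {x : K} (hx : Valued.v x = 1) (s : ℕ) (u : Fin 3 → Kˣ) :
    u ∈ fixedUnitStabilizer σ (latt (!![1, 0, 0; x, ϖ ^ s, 0; 0, 0, 1] : Matrix (Fin 3) (Fin 3) K)) ↔
      u ∈ fixedUnitTorus σ 3 ∧ Valued.v ((u 1 : K) - u 0) ≤ Valued.v (ϖ ^ s) := by
  rw [fixedUnitStabilizer, Subgroup.mem_inf]
  exact ⟨fun ⟨h1, h2⟩ => ⟨h2, (mem_latticeStabilizer_latt_axis3_iff hϖ0 hx s ((mem_fixedUnitTorus_iff σ u).1 h2).1).1 h1⟩,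
    fun ⟨h2, h1⟩ => ⟨(mem_latticeStabilizer_latt_axis3_iff hϖ0 hx s ((mem_fixedUnitTorus_iff σ u).1 h2).1).2 h1, h2⟩⟩

/-- **(T₃·e) THE UNIT TORUS ORBIT IN CLOSED FORM**: `diag(u)·M₃(s,x) = M₃(s, u₁xu₀⁻¹)` for `u ∈ 𝒯` (`diag(u)·V = V′·diag(u)` with `V′` the frame of `x′ = u₁x∕u₀`, and
`latt (V′·diag u) = latt V′`). [cite: Kottwitz1986BaseChangeUnits, §1 pp. 240–241] [cite: Serre1980Trees, II §1.1] -/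
theorem mapGL_diagGLUnits_latt_axis3 {ϖ : K} (hϖ0 : ϖ ≠ 0) {u : Fin 3 → Kˣ} (hu : u ∈ unitTorus K 3) (x : K) (s : ℕ) :
    mapGL (diagGLUnits u) (latt (!![1, 0, 0; x, ϖ ^ s, 0; 0, 0, 1] : Matrix (Fin 3) (Fin 3) K)) =
      latt (!![1, 0, 0; (u 1 : K) * x * ((u 0 : K))⁻¹, ϖ ^ s, 0; 0, 0, 1] : Matrix (Fin 3) (Fin 3) K) := by
  have hu' := (mem_unitTorus_iff u).1 hu
  have hmat : (Matrix.diagonal fun i => (u i : K)) * (!![1, 0, 0; x, ϖ ^ s, 0; 0, 0, 1] : Matrix (Fin 3) (Fin 3) K) =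
      !![1, 0, 0; (u 1 : K) * x * ((u 0 : K))⁻¹, ϖ ^ s, 0; 0, 0, 1] * Matrix.diagonal fun i => (u i : K) := by
    have hdiag : (Matrix.diagonal fun i => (u i : K)) = !![((u 0 : Kˣ) : K), 0, 0; 0, ((u 1 : Kˣ) : K), 0; 0, 0, ((u 2 : Kˣ) : K)] := by
      ext i j; fin_cases i <;> fin_cases j <;> simp
    rw [hdiag]
    ext i j
    fin_cases i <;> fin_cases j <;> simp [Matrix.mul_apply, Fin.sum_univ_three]
    exact mul_comm _ _
  rw [mapGL, ← latt_mul, coe_diagGLUnits, hmat]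
  exact latt_mul_eq_latt_of_isIntMatrix (isUnit_iff_ne_zero.2 (det_axis3_ne_zero hϖ0 _ s))
    (by rw [isUnit_iff_ne_zero, (Valuation.ne_zero_iff Valued.v).symm, v_det_diagonal_eq_one hu']; exact one_ne_zero)
    (isIntMatrix_diagonal_of_v_le fun i => (hu' i).le) (isIntMatrix_diagonal_inv_of_v_eq_one hu')

/-- **(T₃·a′) A DUALISABLE AXIS-3 LATTICE HAS EVEN DEPTH**: `IsDualisableLattice σ ϖ (M₃(s,x)) → 2 ∣ s` for a unit `x` (the axis `M₃ ∩ Ke₁ = 𝔭^s e₁` at the normalised slot 1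
and FILE 1 §4: the dualising `D₁` is `σ`-fixed of valuation `|ϖ|^{−s}`, and fixed elements have even valuation). [cite: Jacobowitz1962, §7] [cite: Rogawski1990, §4.9 Prop. 4.9.1 (a) p. 55] -/
theorem two_dvd_of_isDualisableLattice_latt_axis3 {σ : K →+* K} (hvσ : ∀ a, Valued.v (σ a) = Valued.v a)
    (hfix : ∀ x : K, σ x = x → x ≠ 0 → ∃ n : ℤ, Valued.v x = WithZero.exp (2 * n)) {ϖ : K} (hϖ : Valued.v ϖ = WithZero.exp (-1 : ℤ))
    {x : K} (hx : Valued.v x = 1) {s : ℕ} (hM : IsDualisableLattice σ ϖ (latt (!![1, 0, 0; x, ϖ ^ s, 0; 0, 0, 1] : Matrix (Fin 3) (Fin 3) K))) : 2 ∣ s := by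
  have hϖ0 : ϖ ≠ 0 := fun h0 => by rw [h0, map_zero] at hϖ; exact WithZero.coe_ne_zero hϖ.symm
  have hϖ1 : Valued.v ϖ ≤ 1 := by rw [hϖ, ← WithZero.exp_zero, WithZero.exp_le_exp]; norm_num
  have hps : (ϖ ^ s : K) ≠ 0 := pow_ne_zero _ hϖ0
  have hmem : ∀ w : K, (Pi.single 1 w : Fin 3 → K) ∈ latt (!![1, 0, 0; x, ϖ ^ s, 0; 0, 0, 1] : Matrix (Fin 3) (Fin 3) K) ↔ Valued.v w ≤ Valued.v (ϖ ^ s) := by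
    intro w
    rw [show (!![1, 0, 0; x, ϖ ^ s, 0; 0, 0, 1] : Matrix (Fin 3) (Fin 3) K) = Matrix.of ![![1, 0, 0], ![x, ϖ ^ s, 0], ![0, 0, 1]] from rfl,
      mem_latt_hnf_iff x 0 0 hps one_ne_zero]
    simp
  have hN := isNormalisedLattice_latt_axis3 hϖ1 hx s 1
  exact two_dvd_of_isDualisableLattice_of_axis hvσ hfix hϖ hM 1 ((hmem _).2 le_rfl) (fun w hw => (hmem w).1 hw) hN.1 hN.2

/-- **(T₃·j) THE LOOSE SPEC SHAPE**: for a NORMALISED `M` and `s ≥ 1`, `(∃ x y z, M = latt (1 0 0; x ϖ^s 0; y z 1)) ↔ ∃ x, |x| = 1 ∧ M = M₃(s,x)` — at `c = 0` the parameters `y, z`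
are absorbed (★ `latt_hnf_eq_latt_hnf_iff`-class: `latt (1 0 0; x ϖ^s 0; y z 1) = M₃(s,x)` for integral `y, z`) and normalisation at slot 1 forces `|x| = 1`.
[cite: Serre1980Trees, II §1.1] [cite: Kottwitz1986BaseChangeUnits, §1 pp. 240–241] -/
theorem axis3_hnf_iff {ϖ : K} (hϖ : Valued.v ϖ = WithZero.exp (-1 : ℤ)) {s : ℕ} (hs : 1 ≤ s) {M : Submodule 𝒪[K] (Fin 3 → K)} (hM : IsNormalisedLattice M) :
    (∃ x y z : K, M = latt (!![1, 0, 0; x, ϖ ^ s, 0; y, z, 1] : Matrix (Fin 3) (Fin 3) K)) ↔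
      ∃ x : K, Valued.v x = 1 ∧ M = latt (!![1, 0, 0; x, ϖ ^ s, 0; 0, 0, 1] : Matrix (Fin 3) (Fin 3) K) := by
  have hϖ0 : ϖ ≠ 0 := fun h0 => by rw [h0, map_zero] at hϖ; exact WithZero.coe_ne_zero hϖ.symm
  have hps : (ϖ ^ s : K) ≠ 0 := pow_ne_zero _ hϖ0
  have hvs : Valued.v (ϖ ^ s) < 1 := by
    rw [map_pow, hϖ, ← WithZero.exp_nsmul, ← WithZero.exp_zero, WithZero.exp_lt_exp]; simp; omega
  constructor
  · rintro ⟨x, y, z, rfl⟩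
    -- integrality of the parameters from normalisation (columns 0 and 1 lie in `M`)
    have hc0 : (![1, x, y] : Fin 3 → K) ∈ latt (!![1, 0, 0; x, ϖ ^ s, 0; y, z, 1] : Matrix (Fin 3) (Fin 3) K) := by
      have h := mulVec_single_mem_latt (!![1, 0, 0; x, ϖ ^ s, 0; y, z, 1] : Matrix (Fin 3) (Fin 3) K) 0
      have e : (!![1, 0, 0; x, ϖ ^ s, 0; y, z, 1] : Matrix (Fin 3) (Fin 3) K) *ᵥ Pi.single 0 1 = ![1, x, y] := by
        ext i; fin_cases i <;> simp [Matrix.mulVec, dotProduct, Fin.sum_univ_three]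
      rwa [e] at h
    have hc1 : (![0, ϖ ^ s, z] : Fin 3 → K) ∈ latt (!![1, 0, 0; x, ϖ ^ s, 0; y, z, 1] : Matrix (Fin 3) (Fin 3) K) := by
      have h := mulVec_single_mem_latt (!![1, 0, 0; x, ϖ ^ s, 0; y, z, 1] : Matrix (Fin 3) (Fin 3) K) 1
      have e : (!![1, 0, 0; x, ϖ ^ s, 0; y, z, 1] : Matrix (Fin 3) (Fin 3) K) *ᵥ Pi.single 1 1 = ![0, ϖ ^ s, z] := by
        ext i; fin_cases i <;> simp [Matrix.mulVec, dotProduct, Fin.sum_univ_three]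
      rwa [e] at h
    have hx1 : Valued.v x ≤ 1 := by simpa using (hM 1).1 _ hc0
    have hy1 : Valued.v y ≤ 1 := by simpa using (hM 2).1 _ hc0
    have hz1 : Valued.v z ≤ 1 := by simpa using (hM 2).1 _ hc1
    -- slot 1 attains a unit ⇒ `|x| = 1`
    have hx : Valued.v x = 1 := by
      obtain ⟨w, hw, hw1⟩ := (hM 1).2
      rw [show (!![1, 0, 0; x, ϖ ^ s, 0; y, z, 1] : Matrix (Fin 3) (Fin 3) K) = Matrix.of ![![1, 0, 0], ![x, ϖ ^ s, 0], ![y, z, 1]] from rfl,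
        mem_latt_hnf_iff x y z hps one_ne_zero] at hw
      by_contra hne
      have hlt : Valued.v x < 1 := lt_of_le_of_ne hx1 hne
      have : Valued.v (w 1) < 1 := by
        have e : w 1 = (w 1 - x * w 0) + x * w 0 := by ring
        rw [e]
        refine (Valuation.map_add _ _ _).trans_lt (max_lt (hw.2.1.trans_lt hvs) ?_)
        rw [map_mul]; exact mul_lt_one_of_lt_of_le hlt hw.1
      exact (lt_irrefl _) (hw1 ▸ this)
    refine ⟨x, hx, ?_⟩
    rw [show (!![1, 0, 0; x, ϖ ^ s, 0; y, z, 1] : Matrix (Fin 3) (Fin 3) K) = Matrix.of ![![1, 0, 0], ![x, ϖ ^ s, 0], ![y, z, 1]] from rfl,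
      show (!![1, 0, 0; x, ϖ ^ s, 0; 0, 0, 1] : Matrix (Fin 3) (Fin 3) K) = Matrix.of ![![1, 0, 0], ![x, ϖ ^ s, 0], ![0, 0, 1]] from rfl,
      F0P3cDyRamDiagonalStableLatticeHNFExists.latt_hnf_eq_latt_hnf_iff x y z x 0 0 hps one_ne_zero]
    refine ⟨by rw [sub_self, map_zero]; exact zero_le, by rw [sub_zero, map_one]; exact hz1, ?_⟩
    rw [sub_self, mul_zero, sub_zero, sub_zero, mul_one, map_mul]
    exact mul_le_of_le_one_left' hy1
  · rintro ⟨x, -, rfl⟩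
    exact ⟨x, 0, 0, rfl⟩

/-- (T₃·c′) Stability read for `T = diag(α, β, γ)`: `T·M₃(s,x) = M₃(s,x) ↔ |β − α| ≤ |ϖ^s|` (the depth of `T` on the plane `⟨e₀,e₁⟩` is at least `s`).
[cite: Kottwitz1986BaseChangeUnits, §1 pp. 240–241] -/
theorem mapGL_latt_axis3_eq_iff_of_diagonal {ϖ : K} (hϖ0 : ϖ ≠ 0) {α β γ : K} (hα : Valued.v α = 1) (hβ : Valued.v β = 1) (hγ : Valued.v γ = 1)
    (T : GL (Fin 3) K) (hT : (T : Matrix (Fin 3) (Fin 3) K) = Matrix.diagonal ![α, β, γ]) {x : K} (hx : Valued.v x = 1) (s : ℕ) :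
    mapGL T (latt (!![1, 0, 0; x, ϖ ^ s, 0; 0, 0, 1] : Matrix (Fin 3) (Fin 3) K)) = latt (!![1, 0, 0; x, ϖ ^ s, 0; 0, 0, 1] : Matrix (Fin 3) (Fin 3) K) ↔
      Valued.v (β - α) ≤ Valued.v (ϖ ^ s) := by
  have hu : ∀ i, Valued.v ((![α, β, γ] : Fin 3 → K) i) = 1 := by intro i; fin_cases i <;> assumption
  exact mapGL_latt_axis3_eq_iff hϖ0 ![α, β, γ] hu T hT hx s

/-! ## §2  Axis 3: the two indices `[𝒯 : S̃(M₃)] = (q−1)q^{s−1}` and `[𝒰 : S_F(M₃)] = (q−1)q^{⌈s∕2⌉−1}` via the character `u ↦ u₁u₀⁻¹` and ★ B1 (C3)(C4) -/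

/-- **`[𝒯 : S̃(M₃(s,x))] = (q − 1)·q^{s−1}`** (`s ≥ 1`, `x` a unit): the character `φ(u) = u₁u₀⁻¹` maps the unit torus `𝒯` onto `𝒪^×` and `S̃ = 𝒯 ∩ φ⁻¹(1 + 𝔭^s)`, so the index
is ★ (C3) `[𝒪^× : 1 + 𝔭^s]` (FILE 1 §3). [cite: Serre1979, Ch. IV §2 Prop. 6] [cite: Kottwitz1986BaseChangeUnits, §1 pp. 240–241] -/
theorem relIndex_unitStabilizer_latt_axis3 {ϖ : K} (hϖ : Valued.v ϖ = WithZero.exp (-1 : ℤ)) [Finite 𝓀[K]] {x : K} (hx : Valued.v x = 1)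
    {s : ℕ} (hs : 1 ≤ s) :
    (unitStabilizer (latt (!![1, 0, 0; x, ϖ ^ s, 0; 0, 0, 1] : Matrix (Fin 3) (Fin 3) K))).relIndex (unitTorus K 3) =
      (Nat.card 𝓀[K] - 1) * Nat.card 𝓀[K] ^ (s - 1) := by
  have hϖ0 : ϖ ≠ 0 := fun h0 => by rw [h0, map_zero] at hϖ; exact WithZero.coe_ne_zero hϖ.symm
  exact relIndex_unitTorus_of_coordCongr hϖ (by decide) hs _ (mem_unitStabilizer_latt_axis3_iff hϖ0 hx s)

/-- **`[𝒰 : S_F(M₃(s,x))] = (q − 1)·q^{⌈s∕2⌉−1}`** (`s ≥ 1`, `x` a unit; `⌈s∕2⌉ = (s+1)∕2` in `ℕ`): the same character maps `𝒰 = (𝒪_F^×)³` onto `𝒪_F^×` with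
`S_F = 𝒰 ∩ φ⁻¹(1 + 𝔭_E^s)`, so the index is ★ (C4) `[𝒪_F^× : 𝒪_F^× ∩ (1 + 𝔭_E^s)]`. [cite: Serre1979, Ch. IV §2 Prop. 6] [cite: Rogawski1990, §4.9 Prop. 4.9.1 (a) p. 55] -/
theorem relIndex_fixedUnitStabilizer_latt_axis3 {σ : K →+* K} (hσ : ∀ a, σ (σ a) = a) (hvσ : ∀ a, Valued.v (σ a) = Valued.v a)
    (hfix : ∀ x : K, σ x = x → x ≠ 0 → ∃ n : ℤ, Valued.v x = WithZero.exp (2 * n)) {ϖ : K} (hϖ : Valued.v ϖ = WithZero.exp (-1 : ℤ))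
    {d : ℕ} (hd : Valued.v (ϖ - σ ϖ) = Valued.v ϖ ^ d) [Finite 𝓀[K]] {x : K} (hx : Valued.v x = 1) {s : ℕ} (hs : 1 ≤ s) :
    (fixedUnitStabilizer σ (latt (!![1, 0, 0; x, ϖ ^ s, 0; 0, 0, 1] : Matrix (Fin 3) (Fin 3) K))).relIndex (fixedUnitTorus σ 3) =
      (Nat.card 𝓀[K] - 1) * Nat.card 𝓀[K] ^ ((s + 1) / 2 - 1) := by
  have hϖ0 : ϖ ≠ 0 := fun h0 => by rw [h0, map_zero] at hϖ; exact WithZero.coe_ne_zero hϖ.symm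
  exact relIndex_fixedUnitTorus_of_coordCongr hσ hvσ hfix hϖ hd (by decide) hs _ (mem_fixedUnitStabilizer_latt_axis3_iff σ hϖ0 hx s)

/-- **(T₃·f) THE WEIGHT OF AN AXIS-3 LATTICE**: `stabiliserWeight σ (M₃(s,x)) = 1 ∕ ((q−1)·q^{⌈s∕2⌉−1})` for `s ≥ 1` and a unit `x`.
[cite: Rogawski1990, §4.9 Prop. 4.9.1 (a) p. 55] [cite: Kottwitz1986BaseChangeUnits, §1 pp. 240–241] -/
theorem stabiliserWeight_latt_axis3 {σ : K →+* K} (hσ : ∀ a, σ (σ a) = a) (hvσ : ∀ a, Valued.v (σ a) = Valued.v a)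
    (hfix : ∀ x : K, σ x = x → x ≠ 0 → ∃ n : ℤ, Valued.v x = WithZero.exp (2 * n)) {ϖ : K} (hϖ : Valued.v ϖ = WithZero.exp (-1 : ℤ))
    {d : ℕ} (hd : Valued.v (ϖ - σ ϖ) = Valued.v ϖ ^ d) [Finite 𝓀[K]] {x : K} (hx : Valued.v x = 1) {s : ℕ} (hs : 1 ≤ s) :
    stabiliserWeight σ (latt (!![1, 0, 0; x, ϖ ^ s, 0; 0, 0, 1] : Matrix (Fin 3) (Fin 3) K)) =
      ((((Nat.card 𝓀[K] - 1) * Nat.card 𝓀[K] ^ ((s + 1) / 2 - 1) : ℕ) : ℚ))⁻¹ := by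
  rw [stabiliserWeight, relIndex_fixedUnitStabilizer_latt_axis3 hσ hvσ hfix hϖ hd hx hs]

/-! ## §3  Axis 3: the stratum `𝒮₃(s) = {M ∈ 𝓛₀(T) dualisable, M = M₃(s,x), |x| = 1}` is the `𝒯`-orbit of `M₃(s,1)`; its cardinality and its weighted count `q^{s∕2}` -/

/-- **(T₃·g) THE STRATUM IS A UNIT-TORUS ORBIT.**  For `T = diag(α, β, γ)` with unit entries and `|α − β| = |ϖ|^{n₃}`, `2 ∣ s`, `s ≤ n₃`:
`{M ∈ 𝓛₀(T) | M dualisable, M = M₃(s,x) for a unit x} = 𝒯 · M₃(s,1)` — every `M₃(s,x)` is `T`-stable (depth `s ≤ n₃`), normalised and dualisable (even depth), and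
`diag(u)·M₃(s,1) = M₃(s, u₁u₀⁻¹)`. [cite: Kottwitz1986BaseChangeUnits, §1 pp. 240–241] [cite: Rogawski1990, §4.9 Prop. 4.9.1 (a) p. 55] -/
theorem axis3Stratum_eq_orbit {σ : K →+* K} (hσ : ∀ a, σ (σ a) = a) (hvσ : ∀ a, Valued.v (σ a) = Valued.v a)
    {ϖ : K} (hϖ : Valued.v ϖ = WithZero.exp (-1 : ℤ)) (T : GL (Fin 3) K) {α β γ : K} (hT : (T : Matrix (Fin 3) (Fin 3) K) = Matrix.diagonal ![α, β, γ])
    (hα : Valued.v α = 1) (hβ : Valued.v β = 1) (hγ : Valued.v γ = 1) {n₃ : ℕ} (h₃ : Valued.v (α - β) = Valued.v ϖ ^ n₃) {s : ℕ} (h2 : 2 ∣ s) (hn : s ≤ n₃) :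
    {M : Submodule 𝒪[K] (Fin 3 → K) | M ∈ normalisedStableLattices T ∧ IsDualisableLattice σ ϖ M ∧
        ∃ x : K, Valued.v x = 1 ∧ M = latt (!![1, 0, 0; x, ϖ ^ s, 0; 0, 0, 1] : Matrix (Fin 3) (Fin 3) K)} =
      {M | ∃ u ∈ unitTorus K 3, M = mapGL (diagGLUnits u) (latt (!![1, 0, 0; 1, ϖ ^ s, 0; 0, 0, 1] : Matrix (Fin 3) (Fin 3) K))} := by
  have hϖ0 : ϖ ≠ 0 := fun h0 => by rw [h0, map_zero] at hϖ; exact WithZero.coe_ne_zero hϖ.symm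
  have hϖ1 : Valued.v ϖ ≤ 1 := by rw [hϖ, ← WithZero.exp_zero, WithZero.exp_le_exp]; norm_num
  have hstab : Valued.v (β - α) ≤ Valued.v (ϖ ^ s) := by
    rw [Valuation.map_sub_swap, h₃]; exact (v_pow_le_v_pow_iff hϖ s n₃).2 hn
  ext M
  simp only [Set.mem_setOf_eq]
  constructor
  · rintro ⟨-, -, x, hx, rfl⟩
    have hx0 : x ≠ 0 := fun h => by rw [h, map_zero] at hx; exact zero_ne_one hx
    have hu : (![1, Units.mk0 x hx0, 1] : Fin 3 → Kˣ) ∈ unitTorus K 3 := by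
      rw [mem_unitTorus_iff]; intro i; fin_cases i <;> simp [hx]
    refine ⟨![1, Units.mk0 x hx0, 1], hu, ?_⟩
    rw [mapGL_diagGLUnits_latt_axis3 hϖ0 hu 1 s]
    simp
  · rintro ⟨u, hu, rfl⟩
    rw [mapGL_diagGLUnits_latt_axis3 hϖ0 hu 1 s]
    have h0 := (mem_unitTorus_iff u).1 hu 0
    have h1 := (mem_unitTorus_iff u).1 hu 1
    have hx : Valued.v ((u 1 : K) * 1 * ((u 0 : K))⁻¹) = 1 := by rw [map_mul, map_mul, map_inv₀, h1, h0, map_one]; simp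
    refine ⟨⟨⟨Matrix.GeneralLinearGroup.mkOfDetNeZero _ (det_axis3_ne_zero hϖ0 _ s), rfl⟩, ?_, isNormalisedLattice_latt_axis3 hϖ1 hx s⟩,
      isDualisableLattice_latt_axis3 hσ hvσ hϖ hx h2, _, hx, rfl⟩
    exact (mapGL_latt_axis3_eq_iff_of_diagonal hϖ0 hα hβ hγ T hT hx s).2 hstab

/-- **(T₃·h) THE STRATUM IS EMPTY ABOVE THE DEPTH**: for `n₃ < s` no `M₃(s,x)` (`x` a unit) is `T`-stable. [cite: Kottwitz1986BaseChangeUnits, §1 pp. 240–241] -/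
theorem axis3Stratum_eq_empty (σ : K →+* K) {ϖ : K} (hϖ : Valued.v ϖ = WithZero.exp (-1 : ℤ)) (T : GL (Fin 3) K) {α β γ : K}
    (hT : (T : Matrix (Fin 3) (Fin 3) K) = Matrix.diagonal ![α, β, γ]) (hα : Valued.v α = 1) (hβ : Valued.v β = 1) (hγ : Valued.v γ = 1) {n₃ : ℕ}
    (h₃ : Valued.v (α - β) = Valued.v ϖ ^ n₃) {s : ℕ} (hn : n₃ < s) :
    {M : Submodule 𝒪[K] (Fin 3 → K) | M ∈ normalisedStableLattices T ∧ IsDualisableLattice σ ϖ M ∧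
        ∃ x : K, Valued.v x = 1 ∧ M = latt (!![1, 0, 0; x, ϖ ^ s, 0; 0, 0, 1] : Matrix (Fin 3) (Fin 3) K)} = ∅ := by
  have hϖ0 : ϖ ≠ 0 := fun h0 => by rw [h0, map_zero] at hϖ; exact WithZero.coe_ne_zero hϖ.symm
  refine Set.eq_empty_of_forall_notMem fun M ⟨⟨_, hTM, _⟩, _, x, hx, hM⟩ => ?_
  have h := (mapGL_latt_axis3_eq_iff_of_diagonal hϖ0 hα hβ hγ T hT hx s).1 (hM ▸ hTM)
  rw [Valuation.map_sub_swap, h₃, v_pow_le_v_pow_iff hϖ] at h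
  omega

/-- **(T₃·h′) THE STRATUM IS EMPTY AT ODD DEPTH** (exhaustiveness for the consumer: with (T₃·g)∕(T₃·h) every `s` is covered): no `M₃(s,x)` with `s` odd is dualisable.
[cite: Jacobowitz1962, §7] [cite: Rogawski1990, §4.9 Prop. 4.9.1 (a) p. 55] -/
theorem axis3Stratum_eq_empty_of_not_two_dvd {σ : K →+* K} (hvσ : ∀ a, Valued.v (σ a) = Valued.v a)
    (hfix : ∀ x : K, σ x = x → x ≠ 0 → ∃ n : ℤ, Valued.v x = WithZero.exp (2 * n)) {ϖ : K} (hϖ : Valued.v ϖ = WithZero.exp (-1 : ℤ))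
    (T : GL (Fin 3) K) {s : ℕ} (hodd : ¬ 2 ∣ s) :
    {M : Submodule 𝒪[K] (Fin 3 → K) | M ∈ normalisedStableLattices T ∧ IsDualisableLattice σ ϖ M ∧
        ∃ x : K, Valued.v x = 1 ∧ M = latt (!![1, 0, 0; x, ϖ ^ s, 0; 0, 0, 1] : Matrix (Fin 3) (Fin 3) K)} = ∅ := by
  refine Set.eq_empty_of_forall_notMem fun M ⟨_, hD, x, hx, hM⟩ => ?_
  exact hodd (two_dvd_of_isDualisableLattice_latt_axis3 hvσ hfix hϖ hx (hM ▸ hD))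

/-- **(T₃·i) THE NUMBER OF LATTICES IN THE STRATUM**: `#𝒮₃(s) = (q − 1)·q^{s−1}` (`2 ∣ s`, `1 ≤ s ≤ n₃`) — orbit–stabiliser ★ (O1) and ★ (C3).
[cite: Kottwitz1986BaseChangeUnits, §1 pp. 240–241] [cite: Serre1979, Ch. IV §2 Prop. 6] -/
theorem ncard_axis3Stratum {σ : K →+* K} (hσ : ∀ a, σ (σ a) = a) (hvσ : ∀ a, Valued.v (σ a) = Valued.v a)
    {ϖ : K} (hϖ : Valued.v ϖ = WithZero.exp (-1 : ℤ)) [Finite 𝓀[K]] (T : GL (Fin 3) K) {α β γ : K}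
    (hT : (T : Matrix (Fin 3) (Fin 3) K) = Matrix.diagonal ![α, β, γ]) (hα : Valued.v α = 1) (hβ : Valued.v β = 1) (hγ : Valued.v γ = 1) {n₃ : ℕ}
    (h₃ : Valued.v (α - β) = Valued.v ϖ ^ n₃) {s : ℕ} (h2 : 2 ∣ s) (hs : 1 ≤ s) (hn : s ≤ n₃) :
    {M : Submodule 𝒪[K] (Fin 3 → K) | M ∈ normalisedStableLattices T ∧ IsDualisableLattice σ ϖ M ∧
        ∃ x : K, Valued.v x = 1 ∧ M = latt (!![1, 0, 0; x, ϖ ^ s, 0; 0, 0, 1] : Matrix (Fin 3) (Fin 3) K)}.ncard =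
      (Nat.card 𝓀[K] - 1) * Nat.card 𝓀[K] ^ (s - 1) := by
  rw [axis3Stratum_eq_orbit hσ hvσ hϖ T hT hα hβ hγ h₃ h2 hn, ncard_unitTorus_orbit_eq_relIndex_unitStabilizer,
    relIndex_unitStabilizer_latt_axis3 hϖ (map_one _) hs]

/-- **(T₃) HEAD — THE WEIGHTED COUNT OF THE AXIS-3 ON-BRANCH STRATUM IS `q^{s∕2}`.**  For the datum `(σ, ϖ, d)` (involution preserving `|·|`, fixed elements of even
valuation, uniformiser `ϖ`, `|ϖ − σϖ| = |ϖ|^d`), finite residue field (`q = #𝓀`), `T = diag(α, β, γ)` with unit entries and `|α − β| = |ϖ|^{n₃}`, and an EVEN depth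
`2 ≤ s ≤ n₃`:  `∑ᶠ_{M ∈ 𝒮₃(s)} 1∕[𝒰 : S_F(M)] = #𝒮₃(s) ∕ [𝒰 : S_F] = (q−1)q^{s−1} ∕ ((q−1)q^{s∕2−1}) = q^{s∕2}` (MEMO v2 §4 (T), SPEC-StageB §C B4).
[cite: Rogawski1990, §4.9 Prop. 4.9.1 (a) p. 55] [cite: Kottwitz1986BaseChangeUnits, §1 pp. 240–241] -/
theorem finsum_stabiliserWeight_axis3Stratum {σ : K →+* K} (hσ : ∀ a, σ (σ a) = a) (hvσ : ∀ a, Valued.v (σ a) = Valued.v a)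
    (hfix : ∀ x : K, σ x = x → x ≠ 0 → ∃ n : ℤ, Valued.v x = WithZero.exp (2 * n)) {ϖ : K} (hϖ : Valued.v ϖ = WithZero.exp (-1 : ℤ))
    {d : ℕ} (hd : Valued.v (ϖ - σ ϖ) = Valued.v ϖ ^ d) [Finite 𝓀[K]] (T : GL (Fin 3) K) {α β γ : K}
    (hT : (T : Matrix (Fin 3) (Fin 3) K) = Matrix.diagonal ![α, β, γ]) (hα : Valued.v α = 1) (hβ : Valued.v β = 1) (hγ : Valued.v γ = 1) {n₃ : ℕ}
    (h₃ : Valued.v (α - β) = Valued.v ϖ ^ n₃) {s : ℕ} (h2 : 2 ∣ s) (hs : 2 ≤ s) (hn : s ≤ n₃) :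
    ∑ᶠ M ∈ {M : Submodule 𝒪[K] (Fin 3 → K) | M ∈ normalisedStableLattices T ∧ IsDualisableLattice σ ϖ M ∧
        ∃ x : K, Valued.v x = 1 ∧ M = latt (!![1, 0, 0; x, ϖ ^ s, 0; 0, 0, 1] : Matrix (Fin 3) (Fin 3) K)}, stabiliserWeight σ M =
      (Nat.card 𝓀[K] : ℚ) ^ (s / 2) := by
  have hq : 1 < Nat.card 𝓀[K] := Finite.one_lt_card
  have hcard := ncard_axis3Stratum hσ hvσ hϖ T hT hα hβ hγ h₃ h2 (by omega) hn
  have hfin : {M : Submodule 𝒪[K] (Fin 3 → K) | M ∈ normalisedStableLattices T ∧ IsDualisableLattice σ ϖ M ∧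
      ∃ x : K, Valued.v x = 1 ∧ M = latt (!![1, 0, 0; x, ϖ ^ s, 0; 0, 0, 1] : Matrix (Fin 3) (Fin 3) K)}.Finite := by
    refine Set.finite_of_ncard_ne_zero ?_
    rw [hcard]
    exact mul_ne_zero (by omega) (pow_ne_zero _ (by omega))
  rw [finsum_mem_eq_ncard_mul hfin _ ((((Nat.card 𝓀[K] - 1) * Nat.card 𝓀[K] ^ ((s + 1) / 2 - 1) : ℕ) : ℚ))⁻¹ ?_, hcard]
  · obtain ⟨j, rfl⟩ := h2
    have hj : 1 ≤ j := by omega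
    have e1 : (2 * j + 1) / 2 - 1 = j - 1 := by omega
    have e2 : 2 * j / 2 = j := by omega
    have e3 : 2 * j - 1 = j + (j - 1) := by omega
    rw [e1, e2, e3, pow_add]
    have hq1 : ((Nat.card 𝓀[K] - 1 : ℕ) : ℚ) ≠ 0 := by
      rw [Nat.cast_ne_zero]; omega
    have hqj : ((Nat.card 𝓀[K] : ℚ)) ^ (j - 1) ≠ 0 := pow_ne_zero _ (by rw [Nat.cast_ne_zero]; omega)
    push_cast
    field_simp
  · intro M hM
    rw [axis3Stratum_eq_orbit hσ hvσ hϖ T hT hα hβ hγ h₃ ⟨s / 2, by omega⟩ hn] at hM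
    obtain ⟨u, -, rfl⟩ := hM
    rw [stabiliserWeight_mapGL_diagGLUnits, stabiliserWeight_latt_axis3 hσ hvσ hfix hϖ hd (map_one _) (by omega)]

end Valued

end Summit.HodgeConjecture.HodgeConjecture.Cruxes.H413.F0P3cDyRamDiagonalSplitCount

end
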